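import Literature.GroupTheory.CombinatorialGroupTheory.RandomSclFreeGroupConstraintCount
import Literature.GroupTheory.CombinatorialGroupTheory.RandomSclFreeGroupBlockOverlap
import Literature.GroupTheory.CombinatorialGroupTheory.RandomSclFreeGroupCombAdmissible
import HarnessLib

/-!
# Random rigidity of scl (Calegari–Walker 2013): proofs, part 25 — counting words with a comb
configuration (CW Lemmas 4.13–4.14)

D. Calegari, A. Walker, *Random rigidity in the free group*, Geom. Topol. 17 (2013)
[CalegariWalker2013], §4.6. For a FIXED comb configuration (arc `[s, s + Σλ)`, occurrences
`D_i = [t_i, t_i + λ_i)`, flanks `κ_e`), the number of reduced words of length `n` realising it with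
a `g`-regular arc is at most `|F_n| · q^{−E} · (q^{(2ℓmax+g)/2})^{P}`, where `E = Σλ + Σκ` is the
number of letter identifications, and `P` is the number of *pinned* blocks (part 23). This is the
rank computation of Lemma 4.13 (`card_filter_constraints_le`, `two_mul_card_minima_add_le`)
combined with the overlap accounting of Lemma 4.14 (`sum_len_le_card_biUnion_add`,
`card_Ico_inter_blocks_le`) and the admissibility forced by regularity (`admissible_of_regular`).

* **`card_filter_combConfig_le`** — the per-configuration bound.
-/

noncomputable section

namespace Literature.GroupTheory.CombinatorialGroupTheory

section CombCount

open Finset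

open scoped Classical

set_option maxHeartbeats 800000 in
/-- **Words realising a fixed comb configuration are rare (CW Lemma 4.13 + 4.14, per
configuration).** Data: `k ≥ 1`, `n ≥ 1`, complexity `d`, flank/side bound `ℓmax`, regularity
scale `g ≥ 1`; arc start `s`, occurrence starts `t i`, side lengths `lam i` (`i ≤ d`), flank
lengths `kap e` (`1 ≤ e ≤ d`, `kap 0 = kap (d+1) = 0`), all windows inside `[0, n)`. Then the number
of `w ∈ F_n` satisfying the `D`-constraints `w(t_i + j) = w(s + Λ_i + λ_i − 1 − j)⁻¹`, the
`F`-constraints `w(t_e + λ_e + j) = w(t_{e−1} − 1 − j)⁻¹`, and whose arc is `g`-regular, is at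
most `2k (2k−1)^{n−1} · (2k−1)^{−E} · ((2k−1)^{(2ℓmax+g)/2})^{P}` with `E = Σλ + Σκ` and `P` the
number of pinned blocks among the `d + 2` blocks (arc; `[t_i − κ_{i+1}, t_i + λ_i + κ_i)`).
[cite: CalegariWalker2013, Lemmas 4.13 and 4.14] -/
theorem card_filter_combConfig_le {k n d ℓmax g : ℕ} (hk : 1 ≤ k) (hn : 1 ≤ n) (hg : 1 ≤ g)
    (s : ℕ) (t lam kap : ℕ → ℕ)
    (hkap : ∀ e, e < d + 2 → kap e ≤ ℓmax) (hk0 : kap 0 = 0) (hkl : kap (d + 1) = 0)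
    (hs : s + ∑ i ∈ Finset.range (d + 1), lam i ≤ n)
    (ht : ∀ i, i < d + 1 → kap (i + 1) ≤ t i ∧ t i + lam i + kap i ≤ n) :
    ((((reducedWords k n).filter fun w => ∃ vg : ℕ → Fin k × Bool,
        (∀ i (hi : i < n), vg i = w ⟨i, hi⟩) ∧
        (∀ i, i < d + 1 → ∀ j, j < lam i →
          vg (t i + j) = ((vg (s + (∑ i' ∈ Finset.range i, lam i') + (lam i - 1 - j))).1,
            !(vg (s + (∑ i' ∈ Finset.range i, lam i') + (lam i - 1 - j))).2)) ∧
        (∀ e, 1 ≤ e → e ≤ d → ∀ j, j < kap e →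
          vg (t e + lam e + j) = ((vg (t (e - 1) - 1 - j)).1, !(vg (t (e - 1) - 1 - j)).2)) ∧
        (∀ x y, x ≠ y → x + g ≤ ∑ i' ∈ Finset.range (d + 1), lam i' →
          y + g ≤ ∑ i' ∈ Finset.range (d + 1), lam i' →
            ∃ q, q < g ∧ vg (s + x + q) ≠ vg (s + y + q)) ∧
        (∀ x y, x + g ≤ ∑ i' ∈ Finset.range (d + 1), lam i' →
          y + g ≤ ∑ i' ∈ Finset.range (d + 1), lam i' →
            ∃ q, q < g ∧ vg (s + x + q) ≠
              ((vg (s + y + (g - 1 - q))).1, !(vg (s + y + (g - 1 - q))).2))).card : ℕ) : ℝ) ≤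
      2 * k * (2 * k - 1 : ℝ) ^ (n - 1) *
        (2 * k - 1 : ℝ) ^ (-(((∑ i ∈ Finset.range (d + 1), lam i) +
          ∑ e ∈ Finset.range (d + 2), kap e : ℕ) : ℝ)) *
        ((2 * k - 1 : ℝ) ^ (((2 * ℓmax + g : ℕ) : ℝ) / 2)) ^
          (Finset.univ.filter fun u : Fin (d + 2) => ∃ u' : Fin (d + 2), u' ≠ u ∧
            (Finset.Ico (if (u : ℕ) = 0 then s else t (u - 1) - kap u)
                (if (u : ℕ) = 0 then s + ∑ i ∈ Finset.range (d + 1), lam i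
                  else t (u - 1) + lam (u - 1) + kap (u - 1)) ∩
              Finset.Ico (if (u' : ℕ) = 0 then s else t (u' - 1) - kap u')
                (if (u' : ℕ) = 0 then s + ∑ i ∈ Finset.range (d + 1), lam i
                  else t (u' - 1) + lam (u' - 1) + kap (u' - 1))).Nonempty ∧
            ((if (u' : ℕ) = 0 then s else t (u' - 1) - kap u') <
                (if (u : ℕ) = 0 then s else t (u - 1) - kap u) ∨
              ((if (u' : ℕ) = 0 then s else t (u' - 1) - kap u') =
                  (if (u : ℕ) = 0 then s else t (u - 1) - kap u) ∧ u' < u))).card := by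
  -- abbreviations
  set A := Fin k × Bool with hA
  let INV : Fin k × Bool → Fin k × Bool := fun a => (a.1, !a.2)
  have hINV : ∀ a, INV (INV a) = a := by intro a; simp [INV]
  set Ltot := ∑ i ∈ Finset.range (d + 1), lam i with hLtot
  set K := ∑ e ∈ Finset.range (d + 2), kap e with hK
  set q : ℝ := 2 * k - 1 with hq
  have hq1 : (1 : ℝ) ≤ q := by
    rw [hq]; have : (1 : ℝ) ≤ k := by exact_mod_cast hk
    linarith
  have hqpos : 0 < q := by linarith
  set l : Fin (d + 2) → ℕ := fun u => if (u : ℕ) = 0 then s else t (u - 1) - kap u with hl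
  set r : Fin (d + 2) → ℕ := fun u => if (u : ℕ) = 0 then s + Ltot
    else t (u - 1) + lam (u - 1) + kap (u - 1) with hr
  set P := (Finset.univ.filter fun u : Fin (d + 2) => ∃ u' : Fin (d + 2), u' ≠ u ∧
      (Finset.Ico (l u) (r u) ∩ Finset.Ico (l u') (r u')).Nonempty ∧
      (l u' < l u ∨ (l u' = l u ∧ u' < u))).card with hP
  set S := (reducedWords k n).filter fun w => ∃ vg : ℕ → Fin k × Bool,
        (∀ i (hi : i < n), vg i = w ⟨i, hi⟩) ∧
        (∀ i, i < d + 1 → ∀ j, j < lam i →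
          vg (t i + j) = INV (vg (s + (∑ i' ∈ Finset.range i, lam i') + (lam i - 1 - j)))) ∧
        (∀ e, 1 ≤ e → e ≤ d → ∀ j, j < kap e →
          vg (t e + lam e + j) = INV (vg (t (e - 1) - 1 - j))) ∧
        (∀ x y, x ≠ y → x + g ≤ Ltot → y + g ≤ Ltot →
            ∃ q, q < g ∧ vg (s + x + q) ≠ vg (s + y + q)) ∧
        (∀ x y, x + g ≤ Ltot → y + g ≤ Ltot →
            ∃ q, q < g ∧ vg (s + x + q) ≠ INV (vg (s + y + (g - 1 - q)))) with hS
  show ((S.card : ℕ) : ℝ) ≤ 2 * k * q ^ (n - 1) * q ^ (-((Ltot + K : ℕ) : ℝ)) *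
    (q ^ (((2 * ℓmax + g : ℕ) : ℝ) / 2)) ^ P
  have hRHS : 0 ≤ 2 * k * q ^ (n - 1) * q ^ (-((Ltot + K : ℕ) : ℝ)) *
      (q ^ (((2 * ℓmax + g : ℕ) : ℝ) / 2)) ^ P := by positivity
  -- ### admissibility, or the set is empty
  by_cases hadm : (∀ i j, i < d + 1 → j < d + 1 → i ≠ j →
      (Finset.Ico (t i) (t i + lam i) ∩ Finset.Ico (t j) (t j + lam j)).card < g) ∧
    (∀ i, i < d + 1 → (Finset.Ico (t i) (t i + lam i) ∩ Finset.Ico s (s + Ltot)).card < g)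
  swap
  · have hempty : S = ∅ := by
      rw [Finset.eq_empty_iff_forall_notMem]
      intro w hw
      rw [hS, Finset.mem_filter] at hw
      obtain ⟨_, vg, _, hD, _, hreg1, hreg2⟩ := hw
      exact hadm (admissible_of_regular INV hINV vg s (d + 1) t lam hD hg hreg1 hreg2)
    rw [hempty, Finset.card_empty, Nat.cast_zero]
    exact hRHS
  obtain ⟨hadm1, hadm2⟩ := hadm
  -- ### the constraint list
  set prefL : ℕ → ℕ := fun i => ∑ i' ∈ Finset.range i, lam i' with hprefL
  have hpref : ∀ i, i < d + 1 → prefL i + lam i ≤ Ltot := fun i hi => prefixSum_add_le lam hi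
  set natPairs : List (ℕ × ℕ) :=
    ((List.range (d + 1)).flatMap fun i => (List.range (lam i)).map fun j =>
        (s + prefL i + (lam i - 1 - j), t i + j)) ++
    ((List.range (d + 1)).flatMap fun e => if 1 ≤ e then
        (List.range (kap e)).map fun j => (t (e - 1) - 1 - j, t e + lam e + j) else []) with hnat
  have hmemD : ∀ i j, i < d + 1 → j < lam i →
      (s + prefL i + (lam i - 1 - j), t i + j) ∈ natPairs := by
    intro i j hi hj
    rw [hnat, List.mem_append]
    left
    rw [List.mem_flatMap]
    exact ⟨i, List.mem_range.mpr hi, List.mem_map.mpr ⟨j, List.mem_range.mpr hj, rfl⟩⟩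
  have hmemF : ∀ e j, 1 ≤ e → e ≤ d → j < kap e →
      (t (e - 1) - 1 - j, t e + lam e + j) ∈ natPairs := by
    intro e j he1 he2 hj
    rw [hnat, List.mem_append]
    right
    rw [List.mem_flatMap]
    refine ⟨e, List.mem_range.mpr (by omega), ?_⟩
    rw [if_pos he1]
    exact List.mem_map.mpr ⟨j, List.mem_range.mpr hj, rfl⟩
  have hmem : ∀ p ∈ natPairs,
      (∃ i j, i < d + 1 ∧ j < lam i ∧ p = (s + prefL i + (lam i - 1 - j), t i + j)) ∨
      (∃ e j, 1 ≤ e ∧ e ≤ d ∧ j < kap e ∧ p = (t (e - 1) - 1 - j, t e + lam e + j)) := by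
    intro p hp
    rw [hnat, List.mem_append] at hp
    rcases hp with hp | hp
    · left
      rw [List.mem_flatMap] at hp
      obtain ⟨i, hi, hp⟩ := hp
      rw [List.mem_map] at hp
      obtain ⟨j, hj, rfl⟩ := hp
      exact ⟨i, j, List.mem_range.mp hi, List.mem_range.mp hj, rfl⟩
    · right
      rw [List.mem_flatMap] at hp
      obtain ⟨e, he, hp⟩ := hp
      by_cases he1 : 1 ≤ e
      · rw [if_pos he1, List.mem_map] at hp
        obtain ⟨j, hj, rfl⟩ := hp
        have he' := List.mem_range.mp he
        have hj' := List.mem_range.mp hj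
        have hed : e ≤ d := by
          by_contra h
          have : e = d + 1 := by omega
          rw [this, hkl] at hj'
          omega
        exact ⟨e, j, he1, hed, hj', rfl⟩
      · rw [if_neg he1] at hp
        simp at hp
  have hbound : ∀ p ∈ natPairs, p.1 < n ∧ p.2 < n := by
    intro p hp
    rcases hmem p hp with ⟨i, j, hi, hj, rfl⟩ | ⟨e, j, he1, hed, hj, rfl⟩
    · have h1 := hpref i hi
      have h2 := ht i hi
      simp only
      constructor <;> omega
    · have h1 := ht (e - 1) (by omega)
      have h2 := ht e (by omega)
      have h3 : kap (e - 1 + 1) ≤ t (e - 1) := h1.1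
      rw [show e - 1 + 1 = e by omega] at h3
      simp only
      constructor <;> omega
  set cs : List (Fin n × Fin n) := natPairs.pmap
    (fun p hp => ((⟨p.1, hp.1⟩ : Fin n), (⟨p.2, hp.2⟩ : Fin n))) hbound with hcs
  have hcs_mem : ∀ c, c ∈ cs ↔ ∃ p, ∃ hp : p ∈ natPairs,
      c = ((⟨p.1, (hbound p hp).1⟩ : Fin n), (⟨p.2, (hbound p hp).2⟩ : Fin n)) := by
    intro c
    rw [hcs, List.mem_pmap]
    constructor
    · rintro ⟨p, hp, rfl⟩; exact ⟨p, hp, rfl⟩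
    · rintro ⟨p, hp, rfl⟩; exact ⟨p, hp, rfl⟩
  -- ### `S` is contained in the solution set of `cs`
  set Scs := (reducedWords k n).filter fun w : Fin n → Fin k × Bool =>
    ∀ c ∈ cs, w c.2 = ((w c.1).1, !(w c.1).2) with hScs
  have hsub : S ⊆ Scs := by
    intro w hw
    rw [hS, Finset.mem_filter] at hw
    obtain ⟨hwr, vg, hvg, hD, hF, _, _⟩ := hw
    rw [hScs, Finset.mem_filter]
    refine ⟨hwr, fun c hc => ?_⟩
    obtain ⟨p, hp, rfl⟩ := (hcs_mem c).mp hc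
    simp only
    rw [← hvg, ← hvg]
    rcases hmem p hp with ⟨i, j, hi, hj, rfl⟩ | ⟨e, j, he1, hed, hj, rfl⟩
    · exact hD i hi j hj
    · exact hF e he1 hed j hj
  -- ### degenerate constraints: nothing to count
  by_cases hdeg : ∃ c ∈ cs, c.1 = c.2
  · have hempty : Scs = ∅ := by
      rw [Finset.eq_empty_iff_forall_notMem]
      intro w hw
      rw [hScs, Finset.mem_filter] at hw
      obtain ⟨c, hc, hcc⟩ := hdeg
      have h1 := hw.2 c hc
      rw [hcc] at h1
      have h2 := congrArg Prod.snd h1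
      simp at h2
    have : S.card = 0 := by
      rw [← Finset.card_empty, ← hempty]
      apply le_antisymm (Finset.card_le_card hsub) 
      rw [hempty, Finset.card_empty]; exact Nat.zero_le _
    rw [this, Nat.cast_zero]
    exact hRHS
  have hcs1 : ∀ c ∈ cs, c.1 ≠ c.2 := by
    intro c hc hcc; exact hdeg ⟨c, hc, hcc⟩
  -- ### Lemma P and the minima count
  set Mn := (Finset.univ.filter fun x : Fin n =>
      ∀ y : Fin n, (SimpleGraph.fromRel fun x y : Fin n => (x, y) ∈ cs).Reachable x y → x ≤ y)
    with hMn
  set V' := (Finset.univ.filter fun x : Fin n => ∃ c ∈ cs, x = c.1 ∨ x = c.2) with hV'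
  have hLP : Scs.card ≤ 2 * k * (2 * k - 1) ^ (Mn.card - 1) := card_filter_constraints_le hk cs
  have hmin : 2 * Mn.card + V'.card ≤ 2 * n := two_mul_card_minima_add_le cs hcs1
  have hMn1 : 1 ≤ Mn.card := by
    apply Finset.card_pos.mpr
    refine ⟨⟨0, by omega⟩, ?_⟩
    rw [hMn, Finset.mem_filter]
    exact ⟨Finset.mem_univ _, fun y _ => Fin.mk_le_of_le_val (Nat.zero_le _)⟩
  -- ### the blocks cover at most `V'`
  set U := Finset.univ.biUnion fun u : Fin (d + 2) => Finset.Ico (l u) (r u) with hU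
  have hcover : ∀ x ∈ U, ∃ p ∈ natPairs, x = p.1 ∨ x = p.2 := by
    intro x hx
    rw [hU, Finset.mem_biUnion] at hx
    obtain ⟨u, _, hxu⟩ := hx
    rw [Finset.mem_Ico] at hxu
    by_cases hu0 : (u : ℕ) = 0
    · -- the arc
      simp only [hl, hr, hu0, if_true] at hxu
      obtain ⟨i, hi, h1, h2⟩ := exists_lt_prefixSum lam (d + 1) (x - s) (by omega)
      change prefL i ≤ x - s at h1
      change x - s < prefL i + lam i at h2
      refine ⟨_, hmemD i (prefL i + lam i - 1 - (x - s)) hi (by omega), Or.inl ?_⟩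
      simp only
      omega
    · simp only [hl, hr, hu0, if_false] at hxu
      set i := (u : ℕ) - 1 with hi
      have hiu : (u : ℕ) = i + 1 := by omega
      have hid : i < d + 1 := by have := u.2; omega
      rw [hiu] at hxu
      have hti := ht i hid
      rcases lt_or_ge x (t i) with hx1 | hx1
      · -- flank before: an `F`-pair of edge `e = i + 1`
        have hed : i + 1 ≤ d := by
          by_contra h
          have hk' : kap (i + 1) = 0 := by rw [show i + 1 = d + 1 by omega]; exact hkl
          omega
        have hm := hmemF (i + 1) (t i - 1 - x) (by omega) hed (by omega)
        rw [Nat.add_sub_cancel] at hm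
        refine ⟨_, hm, Or.inl ?_⟩
        simp only
        omega
      · rcases lt_or_ge x (t i + lam i) with hx2 | hx2
        · refine ⟨_, hmemD i (x - t i) hid (by omega), Or.inr ?_⟩
          simp only
          omega
        · -- flank after: an `F`-pair of edge `e = i`
          have hi1 : 1 ≤ i := by
            by_contra h
            have hk' : kap i = 0 := by rw [show i = 0 by omega]; exact hk0
            omega
          refine ⟨_, hmemF i (x - t i - lam i) hi1 (by omega) (by omega), Or.inr ?_⟩
          simp only
          omega
  have hUV : U.card ≤ V'.card := by
    have hsubU : U ⊆ V'.image (fun y : Fin n => (y : ℕ)) := by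
      intro x hx
      obtain ⟨p, hp, hxp⟩ := hcover x hx
      rw [Finset.mem_image]
      have hxn : x < n := by rcases hxp with rfl | rfl; exacts [(hbound p hp).1, (hbound p hp).2]
      refine ⟨⟨x, hxn⟩, ?_, rfl⟩
      rw [hV', Finset.mem_filter]
      refine ⟨Finset.mem_univ _, _, (hcs_mem _).mpr ⟨p, hp, rfl⟩, ?_⟩
      rcases hxp with h | h
      · left; exact Fin.ext h
      · right; exact Fin.ext h
    exact (Finset.card_le_card hsubU).trans Finset.card_image_le
  -- ### Lemma O
  have hpair : ∀ u u' : Fin (d + 2), u ≠ u' →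
      (Finset.Ico (l u) (r u) ∩ Finset.Ico (l u') (r u')).Nonempty →
      (Finset.Ico (l u) (r u) ∩ Finset.Ico (l u') (r u')).card ≤ 2 * ℓmax + g := by
    intro u u' huu' _
    have e0 : Finset.Ico s (s + Ltot) = Finset.Ico (s - 0) (s + Ltot + 0) := by simp
    by_cases hu0 : (u : ℕ) = 0 <;> by_cases hu0' : (u' : ℕ) = 0
    · exact absurd (Fin.ext (hu0.trans hu0'.symm)) huu'
    · simp only [hl, hr, hu0, hu0', if_true, if_false]
      set j := (u' : ℕ) - 1 with hj
      have hju : (u' : ℕ) = j + 1 := by omega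
      have hjd : j < d + 1 := by have := u'.2; omega
      rw [hju, e0]
      apply card_Ico_inter_blocks_le (Nat.zero_le _) (Nat.zero_le _) (hkap (j + 1) (by omega))
        (hkap j (by omega))
      rw [Finset.inter_comm]; exact hadm2 j hjd
    · simp only [hl, hr, hu0, hu0', if_true, if_false]
      set i := (u : ℕ) - 1 with hi
      have hiu : (u : ℕ) = i + 1 := by omega
      have hid : i < d + 1 := by have := u.2; omega
      rw [hiu, e0]
      apply card_Ico_inter_blocks_le (hkap (i + 1) (by omega)) (hkap i (by omega)) (Nat.zero_le _)
        (Nat.zero_le _)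
      exact hadm2 i hid
    · simp only [hl, hr, hu0, hu0', if_false]
      set i := (u : ℕ) - 1 with hi
      have hiu : (u : ℕ) = i + 1 := by omega
      have hid : i < d + 1 := by have := u.2; omega
      set j := (u' : ℕ) - 1 with hj
      have hju : (u' : ℕ) = j + 1 := by omega
      have hjd : j < d + 1 := by have := u'.2; omega
      have hij : i ≠ j := by
        intro h; apply huu'; apply Fin.ext; omega
      rw [hiu, hju]
      exact card_Ico_inter_blocks_le (hkap (i + 1) (by omega)) (hkap i (by omega))
        (hkap (j + 1) (by omega)) (hkap j (by omega)) (hadm1 i j hid hjd hij)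
  have hO := sum_len_le_card_biUnion_add l r (2 * ℓmax + g) hpair
  -- ### the blocks have total length `2E`
  have htotal : ∑ u : Fin (d + 2), (r u - l u) = 2 * (Ltot + K) := by
    rw [Fin.sum_univ_succ]
    have h0 : r 0 - l 0 = Ltot := by simp [hl, hr]
    have hsucc : ∀ i : Fin (d + 1), r i.succ - l i.succ = lam i + kap i + kap (i + 1) := by
      intro i
      have hne : ((i.succ : Fin (d + 2)) : ℕ) ≠ 0 := by simp
      have hval : ((i.succ : Fin (d + 2)) : ℕ) = (i : ℕ) + 1 := by simp
      simp only [hl, hr, hval, Nat.add_sub_cancel, Nat.add_one_ne_zero, ↓reduceIte]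
      have := (ht i i.2).1
      omega
    rw [h0, Finset.sum_congr rfl (fun i _ => hsucc i)]
    rw [Finset.sum_add_distrib, Finset.sum_add_distrib]
    rw [Fin.sum_univ_eq_sum_range (fun i => lam i) (d + 1),
      Fin.sum_univ_eq_sum_range (fun i => kap i) (d + 1),
      Fin.sum_univ_eq_sum_range (fun i => kap (i + 1)) (d + 1)]
    have h1 : ∑ i ∈ Finset.range (d + 1), kap i = K := by
      rw [hK]; conv_rhs => rw [Finset.sum_range_succ, hkl, add_zero]
    have h2 : ∑ i ∈ Finset.range (d + 1), kap (i + 1) = K := by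
      rw [hK]; conv_rhs => rw [Finset.sum_range_succ', hk0, add_zero]
    rw [h1, h2, ← hLtot]
    ring
  -- ### assemble the exponent inequality
  have hexp : 2 * Mn.card + 2 * (Ltot + K) ≤ 2 * n + (2 * ℓmax + g) * P := by
    rw [← htotal]
    have hO' : ∑ u : Fin (d + 2), (r u - l u) ≤ U.card + (2 * ℓmax + g) * P := hO
    omega
  -- ### conclusion
  have hcardS : (S.card : ℝ) ≤ 2 * k * q ^ (Mn.card - 1) := by
    have h1 : S.card ≤ 2 * k * (2 * k - 1) ^ (Mn.card - 1) := (Finset.card_le_card hsub).trans hLP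
    have h2 : ((2 * k * (2 * k - 1) ^ (Mn.card - 1) : ℕ) : ℝ) = 2 * k * q ^ (Mn.card - 1) := by
      rw [hq]; push_cast [Nat.cast_sub (show 1 ≤ 2 * k by omega)]; ring
    rw [← h2]; exact_mod_cast h1
  refine hcardS.trans ?_
  have hpow : q ^ (Mn.card - 1) ≤ q ^ (n - 1) * q ^ (-((Ltot + K : ℕ) : ℝ)) *
      (q ^ (((2 * ℓmax + g : ℕ) : ℝ) / 2)) ^ P := by
    rw [← Real.rpow_natCast q (Mn.card - 1), ← Real.rpow_natCast q (n - 1),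
      ← Real.rpow_natCast _ P, ← Real.rpow_mul hqpos.le, ← Real.rpow_add hqpos,
      ← Real.rpow_add hqpos]
    apply Real.rpow_le_rpow_of_exponent_le hq1
    have e1 : ((Mn.card - 1 : ℕ) : ℝ) = (Mn.card : ℝ) - 1 := by
      rw [Nat.cast_sub hMn1]; simp
    have e2 : ((n - 1 : ℕ) : ℝ) = (n : ℝ) - 1 := by rw [Nat.cast_sub hn]; simp
    rw [e1, e2]
    have h3 : ((2 * Mn.card + 2 * (Ltot + K) : ℕ) : ℝ) ≤ ((2 * n + (2 * ℓmax + g) * P : ℕ) : ℝ) := by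
      exact_mod_cast hexp
    push_cast at h3 ⊢
    linarith
  calc 2 * (k : ℝ) * q ^ (Mn.card - 1)
      ≤ 2 * k * (q ^ (n - 1) * q ^ (-((Ltot + K : ℕ) : ℝ)) * (q ^ (((2 * ℓmax + g : ℕ) : ℝ) / 2)) ^ P) :=
        mul_le_mul_of_nonneg_left hpow (by positivity)
    _ = _ := by ring

/-- **Summing over placements: the pinned-set decomposition.** For `B` blocks of fixed lengths
`len u < Lblk` placed at `l u ≤ n`, and `X ≥ 0`:
`Σ_l X^{#pinned(l)} ≤ Σ_S X^{|S|} (n+1)^{B−|S|} (B·Lblk)^{|S|}`. [cite: CalegariWalker2013, Lemma 4.14] -/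
theorem sum_pow_card_pinned_le {B n Lblk : ℕ} (len : Fin B → ℕ) (hlen : ∀ u, len u < Lblk)
    {X : ℝ} (hX : 0 ≤ X) :
    ∑ l : Fin B → Fin (n + 1), X ^ (Finset.univ.filter fun u : Fin B => ∃ u' : Fin B, u' ≠ u ∧
        (Finset.Ico (l u : ℕ) (l u + len u) ∩ Finset.Ico (l u' : ℕ) (l u' + len u')).Nonempty ∧
        ((l u' : ℕ) < l u ∨ ((l u' : ℕ) = l u ∧ u' < u))).card ≤
      ∑ S : Finset (Fin B), X ^ S.card * ((n + 1 : ℝ) ^ (B - S.card) * ((B * Lblk : ℕ) : ℝ) ^ S.card) := by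
  set pin : (Fin B → Fin (n + 1)) → Finset (Fin B) := fun l =>
    Finset.univ.filter fun u : Fin B => ∃ u' : Fin B, u' ≠ u ∧
        (Finset.Ico (l u : ℕ) (l u + len u) ∩ Finset.Ico (l u' : ℕ) (l u' + len u')).Nonempty ∧
        ((l u' : ℕ) < l u ∨ ((l u' : ℕ) = l u ∧ u' < u)) with hpin
  show ∑ l : Fin B → Fin (n + 1), X ^ (pin l).card ≤ _
  rw [← Finset.sum_fiberwise_of_maps_to (g := pin) (t := (Finset.univ : Finset (Finset (Fin B))))
    (fun l _ => Finset.mem_univ _)]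
  apply Finset.sum_le_sum
  intro S _
  have hfib : ∑ l ∈ Finset.univ.filter (fun l : Fin B → Fin (n + 1) => pin l = S), X ^ (pin l).card =
      ∑ l ∈ Finset.univ.filter (fun l : Fin B → Fin (n + 1) => pin l = S), X ^ S.card := by
    apply Finset.sum_congr rfl
    intro l hl
    rw [Finset.mem_filter] at hl
    rw [hl.2]
  rw [hfib, Finset.sum_const, nsmul_eq_mul]
  have hcount := card_filter_pinned_eq_le (n := n + 1) len hlen S
  have hcast : ((Finset.univ.filter fun l : Fin B → Fin (n + 1) => pin l = S).card : ℝ) ≤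
      (n + 1 : ℝ) ^ (B - S.card) * ((B * Lblk : ℕ) : ℝ) ^ S.card := by
    have h1 : ((Finset.univ.filter fun l : Fin B → Fin (n + 1) => pin l = S).card : ℝ) ≤
        (((n + 1) ^ (B - S.card) * (B * Lblk) ^ S.card : ℕ) : ℝ) := by exact_mod_cast hcount
    refine h1.trans (le_of_eq ?_)
    push_cast
    ring
  calc _ ≤ ((n + 1 : ℝ) ^ (B - S.card) * ((B * Lblk : ℕ) : ℝ) ^ S.card) * X ^ S.card :=
        mul_le_mul_of_nonneg_right hcast (by positivity)
    _ = _ := by ring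

end CombCount

end Literature.GroupTheory.CombinatorialGroupTheory

end
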